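import Summits.RiemannHypothesis.RiemannHypothesis.Theses.RuelleBand
import Summits.RiemannHypothesis.RiemannHypothesis.Theses.Strip
import Summits.RiemannHypothesis.RiemannHypothesis.Theorems.AsymptoticCriticalLine.Negative.BandForms

/-!
# `AsymptoticCriticalLine` (crux stmt-RiemannHypothesis-2063, route `RuelleBand`): the interior/edge split

Support file of the line `interior-edge-split` (lead prover-line-stmt-RiemannHypothesis-2063-0; skeleton
`Cruxes/AsymptoticCriticalLine/Lines/interior-edge-split.lean`).  The crux ("ACL", `Θ_ess = 1/2`) is
`∀ ε > 0, {s | ζ s = 0 ∧ 0 < Re s ∧ Re s < 1 ∧ ε ≤ |Re s − 1/2|}.Finite`.  Read along `|Im ρ| → ∞` it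
says that the real parts of the non-trivial zeros accumulate only at `1/2`; an offending accumulation
point `σ₀ ≠ 1/2` is either INTERIOR (`σ₀ ∈ (0,1) ∖ {1/2}`) or an EDGE (`σ₀ ∈ {0,1}`), and by the
reflection `ρ ↦ 1 − ρ` of the zero set only the right half matters.  The two failure modes are the two
registered stubs of the line, and this file lands the kernel-checked GLUE between them and the crux,
with every statement written out over Mathlib's `riemannZeta` (no new definitions):

* `finite_zeros_re_mem_Icc_of_noRightInteriorBand` — COMPACTNESS: if every `σ₀ ∈ (1/2, 1)` has a
  vertical neighbourhood `|Re s − σ₀| < ε` with finitely many zeros ("no right-interior band", the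
  line's stub 1 verbatim), then every closed real-part slab `a ≤ Re s ≤ b` with `1/2 < a`, `b < 1`
  carries finitely many zeros (`IsCompact.elim_nhds_subcover` on `[a, b]`);
* `rightBandSet_finite_of_noRightInteriorBand_of_strip`, `asymptoticCriticalLine_of_noRightInteriorBand_of_strip`
  — the COMPOSITION: stub 1 and a zero-free vertical strip at the edge (the line's stub 2, which is
  VERBATIM route Strip's crux `Strip.StripZeroFreeStrip`, stmt-RiemannHypothesis-10660) give the crux,
  through the one-sided form `Negative.acl_iff_rightBand` (reflection `ρ ↦ 1 − ρ`);
* `noRightInteriorBand_of_asymptoticCriticalLine`, `stripZeroFreeStrip_of_asymptoticCriticalLine` — both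
  CONVERSES (radius `(σ₀ − 1/2)/2`; `δ := min (1/4) (1 − max Re ρ)` over the finite level-`1/4` band —
  the argument of the route's support item `AsymptoticToZeroFreeStrip`, stmt-RiemannHypothesis-10740,
  whose statement `asymptoticToZeroFreeStrip` below proves verbatim);
* `acl_iff_noRightInteriorBand_and_strip` — THE SPLIT IS LOSSLESS:
  `ACL ↔ (no right-interior band) ∧ Strip.StripZeroFreeStrip`; each conjunct is strictly weaker (zeros
  marching to the `1`-line satisfy the first, a genuine second band at some `σ₀ ∈ (1/2,1)` satisfies the
  second), the conjunction is equivalent — so neither stub is the crux in costume;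
* `noInteriorBand_iff_noRightInteriorBand` — the two-sided statement ("no accumulation at any
  `σ₀ ∈ (0,1) ∖ {1/2}`") is the one-sided stub, by the functional equation
  (`Literature.NumberTheory.LFunctions.GeneralizedRH.riemannZeta_one_sub_eq_zero`).

Both stubs are RH-implied OPEN problems (stub 2 since 1896); nothing here claims either.
-/

noncomputable section

namespace Summit.RiemannHypothesis.RiemannHypothesis.Theorems.AsymptoticCriticalLine.InteriorEdgeSplit

open Set Filter Topology
open Summit.RiemannHypothesis.RiemannHypothesis.Theses.RuelleBand (AsymptoticCriticalLine
  AsymptoticToZeroFreeStrip)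
open Summit.RiemannHypothesis.RiemannHypothesis.Theses.Strip (StripZeroFreeStrip)
open Summit.RiemannHypothesis.RiemannHypothesis.Theorems.AsymptoticCriticalLine.Negative
  (rightBandSet acl_iff_rightBand)

/-! ## Compactness: no right-interior band ⟹ every closed interior slab carries finitely many zeros -/

/-- COMPACTNESS LEMMA. If every abscissa `σ₀ ∈ (1/2, 1)` has a vertical neighbourhood
`|Re s − σ₀| < ε` containing only finitely many zeros of `ζ` in the open strip (the line's stub
`stub_noRightInteriorBand`, verbatim), then for `1/2 < a` and `b < 1` the slab `a ≤ Re s ≤ b` contains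
only finitely many zeros: cover the compact interval `[a, b]` by finitely many of the finite-zero
neighbourhoods (`IsCompact.elim_nhds_subcover`). For `b < a` the slab is empty. -/
theorem finite_zeros_re_mem_Icc_of_noRightInteriorBand
    (h1 : ∀ σ₀ : ℝ, 1 / 2 < σ₀ → σ₀ < 1 →
      ∃ ε : ℝ, 0 < ε ∧ {s : ℂ | riemannZeta s = 0 ∧ 0 < s.re ∧ s.re < 1 ∧ |s.re - σ₀| < ε}.Finite)
    {a b : ℝ} (ha : 1 / 2 < a) (hb : b < 1) :
    {s : ℂ | riemannZeta s = 0 ∧ a ≤ s.re ∧ s.re ≤ b}.Finite := by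
  have hKc : IsCompact (Icc a b) := isCompact_Icc
  have hloc : ∀ x ∈ Icc a b, ∃ r : ℝ, 0 < r ∧
      {s : ℂ | riemannZeta s = 0 ∧ 0 < s.re ∧ s.re < 1 ∧ |s.re - x| < r}.Finite := by
    intro x hx
    exact h1 x (by linarith [hx.1]) (by linarith [hx.2])
  choose! r hr hfin using hloc
  obtain ⟨t, htK, hcover⟩ := hKc.elim_nhds_subcover (fun x => Ioo (x - r x) (x + r x))
    (fun x hx => Ioo_mem_nhds (by linarith [hr x hx]) (by linarith [hr x hx]))
  refine ((t.finite_toSet).biUnion fun x hx => hfin x (htK x hx)).subset ?_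
  rintro s ⟨hz, hsa, hsb⟩
  have hsK : s.re ∈ Icc a b := ⟨hsa, hsb⟩
  obtain ⟨x, hxt, hsx⟩ := mem_iUnion₂.1 (hcover hsK)
  refine mem_iUnion₂.2 ⟨x, hxt, hz, by linarith, by linarith, ?_⟩
  rw [abs_sub_lt_iff]
  exact ⟨by linarith [hsx.2], by linarith [hsx.1]⟩

/-- Finitely many zeros in a slab have bounded height: under "no right-interior band", for
`1/2 < a`, `b < 1` there is `T₀` with `Im ρ ≤ T₀` for every zero `ρ` with `a ≤ Re ρ ≤ b` — the slab is
eventually EMPTY along `Im ρ → +∞` (the form consumed by window counts `N(σ, T+1) − N(σ, T)`). -/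
theorem exists_im_le_of_noRightInteriorBand
    (h1 : ∀ σ₀ : ℝ, 1 / 2 < σ₀ → σ₀ < 1 →
      ∃ ε : ℝ, 0 < ε ∧ {s : ℂ | riemannZeta s = 0 ∧ 0 < s.re ∧ s.re < 1 ∧ |s.re - σ₀| < ε}.Finite)
    {a b : ℝ} (ha : 1 / 2 < a) (hb : b < 1) :
    ∃ T₀ : ℝ, ∀ s : ℂ, riemannZeta s = 0 → a ≤ s.re → s.re ≤ b → s.im ≤ T₀ := by
  obtain ⟨T₀, hT₀⟩ := ((finite_zeros_re_mem_Icc_of_noRightInteriorBand h1 ha hb).image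
    Complex.im).bddAbove
  exact ⟨T₀, fun s hz hsa hsb => hT₀ (mem_image_of_mem Complex.im ⟨hz, hsa, hsb⟩)⟩

/-! ## The composition: the two stubs give the crux -/

/-- Under a zero-free edge strip of width `δ`, every zero of the right half-band of level `ε` has its
real part in the compact interval `[1/2 + ε, 1 − δ]`. -/
theorem re_mem_Icc_of_mem_rightBandSet {δ ε : ℝ}
    (hδ : ∀ s : ℂ, riemannZeta s = 0 → 1 - δ < s.re → s.re < 1 → False)
    {s : ℂ} (hs : s ∈ rightBandSet ε) : s.re ∈ Icc (1 / 2 + ε) (1 - δ) := by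
  obtain ⟨hz, hre, hlt⟩ := hs
  refine ⟨hre, ?_⟩
  by_contra h
  exact hδ s hz (not_le.1 h) hlt

/-- COMPOSITION, set form: "no right-interior band" and a zero-free edge strip (route Strip's crux
`StripZeroFreeStrip`, stmt-RiemannHypothesis-10660) make every right half-band
`{ζ = 0, 1/2 + ε ≤ Re s < 1}` (`ε > 0`) finite — its real parts live in the slab `[1/2 + ε, 1 − δ]`. -/
theorem rightBandSet_finite_of_noRightInteriorBand_of_strip
    (h1 : ∀ σ₀ : ℝ, 1 / 2 < σ₀ → σ₀ < 1 →
      ∃ ε : ℝ, 0 < ε ∧ {s : ℂ | riemannZeta s = 0 ∧ 0 < s.re ∧ s.re < 1 ∧ |s.re - σ₀| < ε}.Finite)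
    (h2 : StripZeroFreeStrip) {ε : ℝ} (hε : 0 < ε) : (rightBandSet ε).Finite := by
  obtain ⟨δ, hδ, hstrip⟩ := h2
  refine (finite_zeros_re_mem_Icc_of_noRightInteriorBand h1 (a := 1 / 2 + ε) (b := 1 - δ)
    (by linarith) (by linarith)).subset ?_
  intro s hs
  have hsK := re_mem_Icc_of_mem_rightBandSet hstrip hs
  exact ⟨hs.1, hsK.1, hsK.2⟩

/-- **COMPOSITION (the glue of line `interior-edge-split`).** "No right-interior band" (stub 1) and
route Strip's crux `StripZeroFreeStrip` (stub 2, stmt-RiemannHypothesis-10660) imply the crux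
`RuelleBand.AsymptoticCriticalLine`, through the one-sided form `Negative.acl_iff_rightBand`
(reflection `ρ ↦ 1 − ρ`, Mathlib `riemannZeta_one_sub`). Both hypotheses are RH-implied open
problems; this theorem is the kernel-checked reduction, not a proof of either. -/
theorem asymptoticCriticalLine_of_noRightInteriorBand_of_strip
    (h1 : ∀ σ₀ : ℝ, 1 / 2 < σ₀ → σ₀ < 1 →
      ∃ ε : ℝ, 0 < ε ∧ {s : ℂ | riemannZeta s = 0 ∧ 0 < s.re ∧ s.re < 1 ∧ |s.re - σ₀| < ε}.Finite)
    (h2 : StripZeroFreeStrip) : AsymptoticCriticalLine :=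
  acl_iff_rightBand.2 fun _ hε => rightBandSet_finite_of_noRightInteriorBand_of_strip h1 h2 hε

/-! ## The converses: the split loses nothing -/

/-- ACL ⟹ no right-interior band: around `σ₀ ∈ (1/2, 1)` the neighbourhood of radius `(σ₀ − 1/2)/2`
lies inside the band of that level. -/
theorem noRightInteriorBand_of_asymptoticCriticalLine (h : AsymptoticCriticalLine) :
    ∀ σ₀ : ℝ, 1 / 2 < σ₀ → σ₀ < 1 →
      ∃ ε : ℝ, 0 < ε ∧ {s : ℂ | riemannZeta s = 0 ∧ 0 < s.re ∧ s.re < 1 ∧ |s.re - σ₀| < ε}.Finite := by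
  intro σ₀ hσ _
  refine ⟨(σ₀ - 1 / 2) / 2, by linarith, (h ((σ₀ - 1 / 2) / 2) (by linarith)).subset ?_⟩
  rintro s ⟨hz, h0, h1, hs⟩
  rw [abs_sub_lt_iff] at hs
  refine ⟨hz, h0, h1, ?_⟩
  rw [abs_of_pos (by linarith [hs.2])]
  linarith [hs.2]

/-- ACL ⟹ a zero-free edge strip (the conclusion IS route Strip's crux `Strip.StripZeroFreeStrip`,
stmt-RiemannHypothesis-10660, definitionally; written out here so that no audit mistakes this
CONDITIONAL statement for a proof of that open item): the level-`1/4` band `F` is finite;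
`δ := min (1/4) (1 − max_F Re ρ)` (`δ := 1/4` if `F = ∅`). This is the argument of the route's support
item `AsymptoticToZeroFreeStrip` (stmt-RiemannHypothesis-10740). -/
theorem stripZeroFreeStrip_of_asymptoticCriticalLine (h : AsymptoticCriticalLine) :
    ∃ δ : ℝ, 0 < δ ∧ ∀ s : ℂ, riemannZeta s = 0 → 1 - δ < s.re → s.re < 1 → False := by
  have hF := h (1 / 4) (by norm_num)
  have hmem : ∀ s : ℂ, riemannZeta s = 0 → 3 / 4 < s.re → s.re < 1 →
      s ∈ {s : ℂ | riemannZeta s = 0 ∧ 0 < s.re ∧ s.re < 1 ∧ 1 / 4 ≤ |s.re - 1 / 2|} := by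
    intro s hz hlo hhi
    refine ⟨hz, by linarith, hhi, ?_⟩
    rw [abs_of_pos (by linarith)]
    linarith
  by_cases hne : ({s : ℂ | riemannZeta s = 0 ∧ 0 < s.re ∧ s.re < 1 ∧ 1 / 4 ≤ |s.re - 1 / 2|}).Nonempty
  · obtain ⟨a, haF, hmax⟩ := Set.exists_max_image _ (fun s : ℂ => s.re) hF hne
    obtain ⟨-, -, ha1, -⟩ := haF
    refine ⟨min (1 / 4) (1 - a.re), lt_min (by norm_num) (by linarith), fun s hz hlo hhi => ?_⟩
    have hm1 := min_le_left (1 / 4 : ℝ) (1 - a.re)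
    have hm2 := min_le_right (1 / 4 : ℝ) (1 - a.re)
    have hsa : s.re ≤ a.re := hmax s (hmem s hz (by linarith) hhi)
    linarith
  · exact ⟨1 / 4, by norm_num, fun s hz hlo hhi => hne ⟨s, hmem s hz (by linarith) hhi⟩⟩

/-- The route's support statement `RuelleBand.AsymptoticToZeroFreeStrip` (stmt-RiemannHypothesis-10740:
`AsymptoticCriticalLine → ∃ δ > 0, no zero with 1 − δ < Re s < 1`), verbatim — its conclusion IS
`Strip.StripZeroFreeStrip` definitionally. -/
theorem asymptoticToZeroFreeStrip : AsymptoticToZeroFreeStrip :=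
  fun h => stripZeroFreeStrip_of_asymptoticCriticalLine h

/-- **THE SPLIT IS LOSSLESS**: `ACL ⟺ (no right-interior band) ∧ Strip.StripZeroFreeStrip`. Each
conjunct is strictly weaker than the crux (an infinite family of zeros with `Re ρ_n → 1` satisfies the
first, a genuine second band at some `σ₀ ∈ (1/2, 1)` satisfies the second); the conjunction is
equivalent, so refuters get two independent `¬`-targets and neither stub restates the crux. -/
theorem acl_iff_noRightInteriorBand_and_strip :
    Summit.RiemannHypothesis.RiemannHypothesis.Theses.RuelleBand.AsymptoticCriticalLine ↔
      ((∀ σ₀ : ℝ, 1 / 2 < σ₀ → σ₀ < 1 →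
        ∃ ε : ℝ, 0 < ε ∧ {s : ℂ | riemannZeta s = 0 ∧ 0 < s.re ∧ s.re < 1 ∧ |s.re - σ₀| < ε}.Finite) ∧
      Summit.RiemannHypothesis.RiemannHypothesis.Theses.Strip.StripZeroFreeStrip) :=
  ⟨fun h => ⟨noRightInteriorBand_of_asymptoticCriticalLine h, stripZeroFreeStrip_of_asymptoticCriticalLine h⟩,
    fun h => asymptoticCriticalLine_of_noRightInteriorBand_of_strip h.1 h.2⟩

/-! ## Two-sided form: the functional equation -/

/-- The two-sided statement — no accumulation of real parts of zeros at ANY interior abscissa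
`σ₀ ∈ (0,1)`, `σ₀ ≠ 1/2` (the idea card's `NoInteriorBand`) — is equivalent to the one-sided stub: the
left half follows from the right half by the reflection `s ↦ 1 − s` of the zeros of the open strip
(`Literature.NumberTheory.LFunctions.GeneralizedRH.riemannZeta_one_sub_eq_zero`, from Mathlib
`riemannZeta_one_sub`). -/
theorem noInteriorBand_iff_noRightInteriorBand :
    (∀ σ₀ : ℝ, 0 < σ₀ → σ₀ < 1 → σ₀ ≠ 1 / 2 →
      ∃ ε : ℝ, 0 < ε ∧ {s : ℂ | riemannZeta s = 0 ∧ 0 < s.re ∧ s.re < 1 ∧ |s.re - σ₀| < ε}.Finite) ↔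
    (∀ σ₀ : ℝ, 1 / 2 < σ₀ → σ₀ < 1 →
      ∃ ε : ℝ, 0 < ε ∧ {s : ℂ | riemannZeta s = 0 ∧ 0 < s.re ∧ s.re < 1 ∧ |s.re - σ₀| < ε}.Finite) := by
  refine ⟨fun h σ₀ hσ hσ1 => h σ₀ (by linarith) hσ1 hσ.ne', fun h σ₀ h0 h1 hne => ?_⟩
  rcases lt_or_gt_of_ne hne with hlt | hgt
  · -- left interior point: reflect the finite neighbourhood of `1 - σ₀ ∈ (1/2, 1)`
    obtain ⟨ε, hε, hfin⟩ := h (1 - σ₀) (by linarith) (by linarith)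
    refine ⟨ε, hε, (hfin.image fun s : ℂ => 1 - s).subset ?_⟩
    rintro s ⟨hz, hs0, hs1, hs⟩
    refine ⟨1 - s, ⟨?_, ?_, ?_, ?_⟩, sub_sub_cancel 1 s⟩
    · exact Literature.NumberTheory.LFunctions.GeneralizedRH.riemannZeta_one_sub_eq_zero hz hs0 hs1
    · simp only [Complex.sub_re, Complex.one_re]; linarith
    · simp only [Complex.sub_re, Complex.one_re]; linarith
    · simp only [Complex.sub_re, Complex.one_re]
      rw [abs_sub_lt_iff] at hs ⊢
      exact ⟨by linarith [hs.2], by linarith [hs.1]⟩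
  · exact h σ₀ hgt h1

/-- ACL in two-sided split form: `ACL ⟺ (no interior band at any σ₀ ∈ (0,1) ∖ {1/2}) ∧ StripZeroFreeStrip`
(the idea card's `InteriorEdgeSplit`, verbatim up to unfolding). -/
theorem acl_iff_noInteriorBand_and_strip :
    AsymptoticCriticalLine ↔
      ((∀ σ₀ : ℝ, 0 < σ₀ → σ₀ < 1 → σ₀ ≠ 1 / 2 →
        ∃ ε : ℝ, 0 < ε ∧ {s : ℂ | riemannZeta s = 0 ∧ 0 < s.re ∧ s.re < 1 ∧ |s.re - σ₀| < ε}.Finite) ∧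
      StripZeroFreeStrip) := by
  rw [acl_iff_noRightInteriorBand_and_strip, noInteriorBand_iff_noRightInteriorBand]

end Summit.RiemannHypothesis.RiemannHypothesis.Theorems.AsymptoticCriticalLine.InteriorEdgeSplit

end
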